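import Literature.NumberTheory.LFunctions.SuzukiScrewLineProofs
import Literature.NumberTheory.LFunctions.GeneralizedRH
import Literature.NumberTheory.LFunctions.ZetaLogDerivRealBound
import Literature.NumberTheory.LFunctions.SmoothedExplicitFormulaTrivialZeros
import Mathlib.Analysis.Calculus.SmoothSeries
import HarnessLib

/-!
# Suzuki's screw line: the special value (7.2) and the discharge of CJM Thm 7.1

LINE 1 — LABEL: RH-FREE corpus theorem. This file DISCHARGES the named fact
`Literature.NumberTheory.LFunctions.Suzuki2025_thm71` of `SuzukiScrewLine.lean`
(M. Suzuki, *On the Hilbert space derived from the Weil distribution*, Canad. J. Math. (2025)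
= arXiv:2301.00421v3, **Thm 7.1** = arXiv:2209.04658v3 Thm 4.1, "independently of the truth of
the RH"): `theorem Suzuki2025_thm71_holds : Suzuki2025_thm71`. Its first conjunct (7.1)
`lim_{z→0} 𝔓_t(z) = Ψ(t)` is `Suzuki2025_thm71_eq71` (`SuzukiScrewLineProofs.lean`); here we prove
the second conjunct (7.2)

  `lim_{y→+∞, y ∉ 2ℕ+½} [ y·𝔓_t(−iy) − ½(Γ′/Γ)(¼ + y/2) + ½ log π ] = −g_ξ′(t) = Ψ′(t)`
  (`t > 0`, `t ≠ log n`), `Ψ = zetaScrew`,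

as typed: the limit is taken along `atTop ⊓ 𝓟 {y | ∀ n, y ≠ 2n + ½}`, i.e. off the abscissae of
the poles of the individual terms of (1.6) but arbitrarily close to them. bears_on: B-C/B-P
(COLUMN 6 DBR). WHAT THIS IS NOT: an unconditional limit identity for an explicit meromorphic
function attached to a printed criterion; discharging it fixes the kernel status of a corpus
statement and does not move RH; nothing here bears on the truth of RH.

## The printed proof and what has to be added

The printed proof (TeX l.2192–2226) multiplies (1.6) by `y`, substitutes `z = −iy`, uses "the
logarithmic derivative of `ξ(s) = ξ(1−s)` at `s = ½ − y`", i.e.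
`ζ′/ζ(½−y) = −ζ′/ζ(½+y) + log π − ½ψ(¼+y/2) − ½ψ(¼−y/2)` (`ScrewValueAtInfinity.logDeriv_zeta_half_sub`,
from `logDeriv_riemannXi_one_sub` and `logDeriv_Gammaℝ`), and reads off the limit
`2(e^{t/2} − e^{−t/2}) − Σ_{n≤e^t} Λ(n)n^{−1/2} + ½[ψ(¼) − log π] + ½e^{−t/2}Φ(e^{−2t},1,¼)`, which is
`−g_ξ′(t)` by (4.3) since `(d/dt)(e^{−t/2}Φ(e^{−2t},2,¼)) = −2e^{−t/2}Φ(e^{−2t},1,¼)` (the printed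
right-hand side has `Φ(·,2,¼)`, a typo; `ScrewValueAtInfinity.hasDerivAt_zetaScrew_of_pos`).
What the text leaves implicit is the behaviour near the poles `y = 2n + ½` (`n ≥ 1`), where THREE
terms of `y𝔓_t(−iy)` are singular — `(e^{−yt}−1)ζ′/ζ(½−y)` (trivial zero at `−2n`),
`−½ψ(¼−y/2)` and the `n`-th term of `−½e^{−t/2}Φ(e^{−2t},1,¼−y/2)` — with principal parts
`(e^{−yt}−1)/(yₙ−y)`, `1/(yₙ−y)`, `−e^{−t yₙ}/(yₙ−y)` (`yₙ = 2n+½`) summing to the harmless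
difference quotient `(e^{−yt} − e^{−yₙt})/(yₙ − y)`. After the functional equation the singular
part is `−½e^{−t/2}·T(a)`, `a = y/2 − ¼`,
`T(a) = e^{−2ta}ψ(−a) + Σ_{n≥0} e^{−2tn}/(n − a)`, and we prove `T(a) → 0` as `a → +∞`, `a ∉ ℕ`
(`ScrewValueAtInfinity.tendsto_poleTerm`) by shifting the digamma with `ψ(w+1) = ψ(w) + 1/w`
(Mathlib `Complex.digamma_apply_add_one`) to `K − a ∈ [¾, 7/4)`, `K = ⌈a + ¾⌉`, where
`|ψ| ≤ log(1+7/4) + 13` (`SmoothedEF.norm_digamma_le_log_uniform`), pairing the finite part of the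
recurrence with the first `K` Lerch terms into difference quotients
`(e^{−2tn} − e^{−2ta})/(n − a)` (bounded by `(n+1)e^{−2tn}/a` for `n ≤ a−1` and by `2te^{−2t(a−1)}`
otherwise), and bounding the Lerch tail by `(4/3)e^{−2tK}/(1−e^{−2t})`; the resulting majorant
`15e^{−2ta} + 2t(a+2)e^{−2t(a−1)} + S₁/a + (4/3)e^{−2ta}/(1−e^{−2t})` tends to `0`. The remaining
limits are elementary: `ζ′/ζ(½+y) → 0` (`norm_deriv_riemannZeta_div_lt`, `|ζ′/ζ(σ)| < 1/(σ−1)`),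
`e^{−yt}ψ(¼+y/2) → 0`, `e^{−y(t − log n)} → 0` for `n ≤ e^t`, `t ≠ log n`, and `ζ(½−y) ≠ 0` off the
trivial zeros (`riemannZeta_eq_zero_iff_of_re_nonpos`). A 30-digit numerical check of the typed
statement (including `y = 40.5 + 10⁻¹²`, `80.5 − 10⁻¹⁵`) accompanied the formalisation.

## References

* M. Suzuki, *On the Hilbert space derived from the Weil distribution*, Canad. J. Math. (2025),
  doi:10.4153/S0008414X25101739 = arXiv:2301.00421v3, §7 Thm 7.1 and its proof (TeX l.2114–2226).
  [Suzuki2025WeilHilbertSpace]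
* M. Suzuki, *The screw line of the Riemann zeta-function and its applications*, arXiv:2209.04658v3,
  Thm 4.1. [Suzuki2022]
-/

noncomputable section

open Filter Topology Finset Complex
open scoped Real

namespace Literature.NumberTheory.LFunctions

namespace ScrewValueAtInfinity

/-! ## §1. The logarithmic derivative of the functional equation at `s = ½ − y` -/


/-- `ξ'/ξ = 1/s + 1/(s−1) + Γ_ℝ'/Γ_ℝ + ζ'/ζ` at every `s ≠ 0, 1` off the poles of `Γ_ℝ` with `ζ(s) ≠ 0`
(no restriction on `Re s`; companion of `logDeriv_riemannXi_eq`). [folklore] -/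
private theorem logDeriv_riemannXi_eq_of_ne {s : ℂ} (h0 : s ≠ 0) (h1 : s ≠ 1)
    (hΓ : ∀ m : ℕ, s / 2 ≠ -m) (hζ : riemannZeta s ≠ 0) :
    logDeriv riemannXi s = 1 / s + 1 / (s - 1) + logDeriv Gammaℝ s + logDeriv riemannZeta s := by
  have hΓs : Gammaℝ s ≠ 0 := by
    rw [Ne, Gammaℝ_eq_zero_iff]
    rintro ⟨n, hn⟩
    exact hΓ n (by rw [hn]; ring)
  have hdΓ : DifferentiableAt ℂ Gammaℝ s := (RealZeros.hasDerivAt_Gammaℝ hΓ).differentiableAt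
  have hΓev : ∀ᶠ z in 𝓝 s, Gammaℝ z ≠ 0 := hdΓ.continuousAt.eventually_ne hΓs
  set F : ℂ → ℂ := fun z ↦ z * (z - 1) / 2 * Gammaℝ z with hF
  have hev : riemannXi =ᶠ[𝓝 s] fun z ↦ F z * riemannZeta z := by
    filter_upwards [hΓev, isOpen_ne.mem_nhds h0, isOpen_ne.mem_nhds h1] with z hz hz0 hz1
    rw [riemannXi_eq_mul_completedRiemannZeta hz0 hz1, riemannZeta_def_of_ne_zero hz0, hF]
    field_simp
  have hFs : F s ≠ 0 :=
    mul_ne_zero (div_ne_zero (mul_ne_zero h0 (sub_ne_zero.2 h1)) two_ne_zero) hΓs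
  have hdF : DifferentiableAt ℂ F s := by simp only [hF]; fun_prop
  have hdζ : DifferentiableAt ℂ riemannZeta s := differentiableAt_riemannZeta h1
  have hpoly : logDeriv (fun z : ℂ ↦ z * (z - 1) / 2) s = 1 / s + 1 / (s - 1) := by
    rw [logDeriv_apply]
    have hd : HasDerivAt (fun z : ℂ ↦ z * (z - 1) / 2) ((1 * (s - 1) + s * 1) / 2) s :=
      ((hasDerivAt_id' s).fun_mul ((hasDerivAt_id' s).sub_const 1)).div_const 2
    rw [hd.deriv]
    have hs1' : s - 1 ≠ 0 := sub_ne_zero.2 h1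
    field_simp
  have hlogF : logDeriv F s = 1 / s + 1 / (s - 1) + logDeriv Gammaℝ s := by
    simp only [hF]
    rw [logDeriv_mul (f := fun z : ℂ ↦ z * (z - 1) / 2) (g := Gammaℝ) s
      (div_ne_zero (mul_ne_zero h0 (sub_ne_zero.2 h1)) two_ne_zero) hΓs (by fun_prop) hdΓ, hpoly]
  rw [logDeriv_congr_of_eventuallyEq hev, logDeriv_mul (f := F) (g := riemannZeta) s hFs hζ hdF hdζ,
    hlogF]

/-- `ζ(½ − y) ≠ 0` for `y > ½` off the trivial-zero abscissae `y = 2n + ½`. [folklore] -/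
private theorem zeta_half_sub_ne_zero {y : ℝ} (hy : 1 / 2 < y) (hpole : ∀ n : ℕ, y ≠ 2 * n + 1 / 2) :
    riemannZeta (1 / 2 - (y : ℂ)) ≠ 0 := by
  intro h
  have hre : (1 / 2 - (y : ℂ)).re ≤ 0 := by simp; linarith
  obtain ⟨n, hn⟩ := (riemannZeta_eq_zero_iff_of_re_nonpos hre).1 h
  have := congrArg Complex.re hn
  simp at this
  exact hpole (n + 1) (by push_cast; linarith)

/-- **Logarithmic derivative of `ξ(s) = ξ(1−s)` at `s = ½ − y`** (`y > ½`, `y ≠ 2n + ½`):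
`ζ'/ζ(½ − y) = −ζ'/ζ(½ + y) + log π − ½ψ(¼ + y/2) − ½ψ(¼ − y/2)`.
[cite: Suzuki2025WeilHilbertSpace, §7 proof of Thm 7.1 (TeX l.2219–2221)] -/
theorem logDeriv_zeta_half_sub {y : ℝ} (hy : 1 / 2 < y) (hpole : ∀ n : ℕ, y ≠ 2 * n + 1 / 2) :
    deriv riemannZeta (1 / 2 - (y : ℂ)) / riemannZeta (1 / 2 - (y : ℂ)) =
      -(deriv riemannZeta (1 / 2 + (y : ℂ)) / riemannZeta (1 / 2 + (y : ℂ))) + (Real.log Real.pi : ℂ)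
        - Complex.digamma (1 / 4 + (y : ℂ) / 2) / 2 - Complex.digamma (1 / 4 - (y : ℂ) / 2) / 2 := by
  set s : ℂ := 1 / 2 - (y : ℂ) with hs
  have h1s : 1 - s = 1 / 2 + (y : ℂ) := by rw [hs]; ring
  -- hypotheses of `logDeriv_riemannXi_eq_of_ne` at `s` and `1 - s`
  have hy0 : y ≠ 1 / 2 := by
    intro h; exact hpole 0 (by rw [h]; norm_num)
  have h0 : s ≠ 0 := by
    intro h; have := congrArg Complex.re h; simp [hs] at this
    exact hy0 (by linarith)
  have h1 : s ≠ 1 := by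
    intro h; have := congrArg Complex.re h; simp [hs] at this; linarith
  have hΓ : ∀ m : ℕ, s / 2 ≠ -m := by
    intro m h; have := congrArg Complex.re h; simp [hs] at this
    exact hpole m (by linarith)
  have hζ : riemannZeta s ≠ 0 := zeta_half_sub_ne_zero hy hpole
  have h0' : 1 - s ≠ 0 := by
    intro h; have := congrArg Complex.re h; simp [hs] at this; linarith
  have h1' : 1 - s ≠ 1 := by
    intro h; have := congrArg Complex.re h; simp [hs] at this; exact hy0 (by linarith)
  have hΓ' : ∀ m : ℕ, (1 - s) / 2 ≠ -m := by
    intro m h; have := congrArg Complex.re h; simp [hs] at this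
    linarith [(m.cast_nonneg : (0 : ℝ) ≤ m)]
  have hζ' : riemannZeta (1 - s) ≠ 0 :=
    riemannZeta_ne_zero_of_one_le_re (by simp [hs]; linarith)
  have hA := logDeriv_riemannXi_eq_of_ne h0 h1 hΓ hζ
  have hA' := logDeriv_riemannXi_eq_of_ne h0' h1' hΓ' hζ'
  have hxi := logDeriv_riemannXi_one_sub s
  rw [hA, hA'] at hxi
  -- the Gamma factors
  have hG : logDeriv Gammaℝ s = -(Complex.log π) / 2 + Complex.digamma (1 / 4 - (y : ℂ) / 2) / 2 := by
    rw [LFunctions.logDeriv_Gammaℝ hΓ, show s / 2 = 1 / 4 - (y : ℂ) / 2 by rw [hs]; ring]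
  have hG' : logDeriv Gammaℝ (1 - s) =
      -(Complex.log π) / 2 + Complex.digamma (1 / 4 + (y : ℂ) / 2) / 2 := by
    rw [LFunctions.logDeriv_Gammaℝ hΓ', show (1 - s) / 2 = 1 / 4 + (y : ℂ) / 2 by rw [hs]; ring]
  have e1 : (1 : ℂ) / (1 - s - 1) + 1 / s = 0 := by
    rw [show (1 : ℂ) - s - 1 = -s by ring]; field_simp; ring
  have e2 : (1 : ℂ) / (1 - s) + 1 / (s - 1) = 0 := by
    have : (1 : ℂ) - s = -(s - 1) := by ring
    rw [this, one_div_neg_eq_neg_one_div]; ring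
  rw [← logDeriv_apply, ← logDeriv_apply, ← h1s]
  have hlogζ : logDeriv riemannZeta s =
      -logDeriv riemannZeta (1 - s) - logDeriv Gammaℝ (1 - s) - logDeriv Gammaℝ s := by
    linear_combination hxi - e1 - e2
  rw [hlogζ, hG, hG', ← Complex.ofReal_log Real.pi_pos.le]
  ring


/-! ## §2. The pole-cancellation term `T(a) = e^{−2ta}ψ(−a) + Σ_n e^{−2tn}/(n − a)` -/


/-- Iterated recurrence `ψ(s + K) = ψ(s) + Σ_{j<K} (s+j)⁻¹` off the poles. [folklore] -/
private theorem digamma_add_nat {s : ℂ} (hs : ∀ j m : ℕ, s + j ≠ -(m : ℂ)) (K : ℕ) :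
    Complex.digamma (s + K) = Complex.digamma s + ∑ j ∈ Finset.range K, (s + j)⁻¹ := by
  induction K with
  | zero => simp
  | succ K ih =>
    have h := Complex.digamma_apply_add_one (s + K) (fun m ↦ hs K m)
    rw [Nat.cast_succ, ← add_assoc, h, ih, Finset.sum_range_succ, add_assoc]

/-- For real `a ∉ ℕ`: `ψ(−a) = ψ(K − a) − Σ_{j<K} (−a + j)⁻¹`. [folklore] -/
private theorem digamma_neg_eq {a : ℝ} (ha : ∀ n : ℕ, a ≠ n) (K : ℕ) :
    Complex.digamma (-(a : ℂ)) =
      Complex.digamma ((K : ℂ) - a) - ∑ j ∈ Finset.range K, (-(a : ℂ) + j)⁻¹ := by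
  have hs : ∀ j m : ℕ, -(a : ℂ) + j ≠ -(m : ℂ) := by
    intro j m h
    apply ha (j + m)
    have h' := congrArg Complex.re h
    simp at h'
    push_cast
    linarith
  have h := digamma_add_nat hs K
  rw [show -(a : ℂ) + K = (K : ℂ) - a by ring] at h
  rw [h]
  ring

/-- `Σ_n e^{−2tn}/(n − a)` converges absolutely for every real `a` (junk `x/0 = 0` at `n = a`).
[folklore] -/
private theorem summable_exp_div_sub {t : ℝ} (ht : 0 < t) (a : ℝ) :
    Summable fun n : ℕ ↦ ((Real.exp (-(2 * t * n)) : ℝ) : ℂ) / ((n : ℂ) - a) := by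
  have hq1 : Real.exp (-(2 * t)) < 1 := (Real.exp_lt_one_iff.2 (by linarith))
  refine Summable.of_norm_bounded_eventually_nat
    (summable_geometric_of_lt_one (Real.exp_pos _).le hq1) ?_
  filter_upwards [eventually_ge_atTop (⌈a⌉₊ + 1)] with n hn
  have hn' : a + 1 ≤ n := by
    have h1 : (⌈a⌉₊ : ℝ) + 1 ≤ n := by exact_mod_cast hn
    linarith [Nat.le_ceil a]
  have hsub : 1 ≤ ‖((n : ℂ) - a)‖ := by
    have : ((n : ℂ) - a) = (((n : ℝ) - a : ℝ) : ℂ) := by push_cast; ring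
    rw [this, Complex.norm_real, Real.norm_eq_abs, abs_of_nonneg (by linarith)]
    linarith
  rw [norm_div, Complex.norm_real, Real.norm_eq_abs, abs_of_pos (Real.exp_pos _),
    show -(2 * t * (n : ℝ)) = (n : ℝ) * (-(2 * t)) by ring, Real.exp_nat_mul]
  exact div_le_self (pow_nonneg (Real.exp_pos _).le _) hsub

/-- Mean-value bound `|e^x − e^y| ≤ |x − y| e^{max x y}`. [folklore] -/
private theorem abs_exp_sub_exp_le (x y : ℝ) :
    |Real.exp x - Real.exp y| ≤ |x - y| * Real.exp (max x y) := by
  wlog hxy : y ≤ x generalizing x y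
  · have h := this y x (le_of_not_ge hxy)
    rwa [abs_sub_comm, abs_sub_comm y x, max_comm] at h
  rw [max_eq_left hxy, abs_of_nonneg (sub_nonneg.2 (Real.exp_le_exp.2 hxy)),
    abs_of_nonneg (sub_nonneg.2 hxy)]
  have h1 := Real.add_one_le_exp (y - x)
  have h2 : Real.exp y = Real.exp x * Real.exp (y - x) := by
    rw [← Real.exp_add]; ring_nf
  nlinarith [Real.exp_pos x, Real.exp_pos (y - x)]

/-- Per-term bound for the head: for `a ≥ 1`, `n ≠ a`,
`|(e^{−2tn} − e^{−2ta})/(n − a)| ≤ (n+1)e^{−2tn}/a + 2t·e^{−2t(a−1)}`. [folklore] -/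
private theorem abs_head_term_le {t a : ℝ} (ht : 0 < t) (ha : 1 ≤ a) {n : ℕ} (hna : a ≠ n) :
    |(Real.exp (-(2 * t * n)) - Real.exp (-(2 * t * a))) / ((n : ℝ) - a)| ≤
      ((n : ℝ) + 1) * Real.exp (-(2 * t * n)) / a + 2 * t * Real.exp (-(2 * t * (a - 1))) := by
  have hn0 : (0 : ℝ) ≤ n := n.cast_nonneg
  have hA : 0 ≤ ((n : ℝ) + 1) * Real.exp (-(2 * t * n)) / a := by positivity
  have hB : 0 ≤ 2 * t * Real.exp (-(2 * t * (a - 1))) := by positivity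
  rcases le_or_gt (n : ℝ) (a - 1) with hfar | hnear
  · -- FAR: `n ≤ a − 1`
    have hpos : 0 < a - n := by linarith
    have hlt : Real.exp (-(2 * t * a)) < Real.exp (-(2 * t * n)) :=
      Real.exp_lt_exp.2 (by nlinarith)
    rw [abs_div, show |(n : ℝ) - a| = a - n by rw [abs_sub_comm]; exact abs_of_pos hpos,
      abs_of_pos (sub_pos.2 hlt)]
    calc (Real.exp (-(2 * t * n)) - Real.exp (-(2 * t * a))) / (a - n)
        ≤ Real.exp (-(2 * t * n)) / (a - n) := by
          gcongr; linarith [Real.exp_pos (-(2 * t * a))]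
      _ ≤ ((n : ℝ) + 1) * Real.exp (-(2 * t * n)) / a := by
          rw [div_le_div_iff₀ hpos (by linarith)]
          have : a ≤ (a - n) * (n + 1) := by nlinarith
          nlinarith [Real.exp_pos (-(2 * t * n))]
      _ ≤ _ := le_add_of_nonneg_right hB
  · -- NEAR: `a − 1 < n < a + 3/4`
    have hne : (n : ℝ) - a ≠ 0 := sub_ne_zero.2 (fun h ↦ hna h.symm)
    have hmvt := abs_exp_sub_exp_le (-(2 * t * n)) (-(2 * t * a))
    have hdiff : |(-(2 * t * n)) - (-(2 * t * a))| = 2 * t * |(n : ℝ) - a| := by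
      rw [show (-(2 * t * n)) - (-(2 * t * a)) = 2 * t * (a - n) by ring, abs_mul,
        abs_of_pos (by linarith : (0:ℝ) < 2 * t), abs_sub_comm]
    have hmax : Real.exp (max (-(2 * t * n)) (-(2 * t * a))) ≤ Real.exp (-(2 * t * (a - 1))) := by
      rw [Real.exp_le_exp, max_le_iff]
      constructor <;> nlinarith
    rw [abs_div]
    calc |Real.exp (-(2 * t * n)) - Real.exp (-(2 * t * a))| / |(n : ℝ) - a|
        ≤ 2 * t * |(n : ℝ) - a| * Real.exp (-(2 * t * (a - 1))) / |(n : ℝ) - a| := by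
          gcongr
          calc |Real.exp (-(2 * t * n)) - Real.exp (-(2 * t * a))|
              ≤ |(-(2 * t * n)) - (-(2 * t * a))| * Real.exp (max (-(2 * t * n)) (-(2 * t * a))) := hmvt
            _ ≤ 2 * t * |(n : ℝ) - a| * Real.exp (-(2 * t * (a - 1))) := by
                rw [hdiff]; gcongr
      _ = 2 * t * Real.exp (-(2 * t * (a - 1))) := by
          field_simp
      _ ≤ _ := le_add_of_nonneg_left hA

/-- The index `K = ⌈a + 3/4⌉`: `a + 3/4 ≤ K < a + 7/4`. [folklore] -/
private theorem ceil_bounds {a : ℝ} (ha : 0 ≤ a) :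
    a + 3 / 4 ≤ (⌈a + 3 / 4⌉₊ : ℝ) ∧ (⌈a + 3 / 4⌉₊ : ℝ) < a + 3 / 4 + 1 :=
  ⟨Nat.le_ceil _, Nat.ceil_lt_add_one (by linarith)⟩

/-- `‖e^{−2ta} ψ(K − a)‖ ≤ 15 e^{−2ta}` for `3/4 ≤ K − a ≤ 7/4`. [folklore] -/
private theorem norm_exp_mul_digamma_le {t a : ℝ} {K : ℕ} (h1 : 3 / 4 ≤ (K : ℝ) - a)
    (h2 : (K : ℝ) - a ≤ 7 / 4) :
    ‖((Real.exp (-(2 * t * a)) : ℝ) : ℂ) * Complex.digamma ((K : ℂ) - a)‖ ≤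
      15 * Real.exp (-(2 * t * a)) := by
  have hw : ((K : ℂ) - a) = ((((K : ℝ) - a : ℝ)) : ℂ) := by push_cast; ring
  have hre : (3 : ℝ) / 4 ≤ (((((K : ℝ) - a : ℝ)) : ℂ)).re := by simp; linarith
  have hψ := SmoothedEF.norm_digamma_le_log_uniform hre
  have hnorm : ‖(((((K : ℝ) - a : ℝ)) : ℂ))‖ = (K : ℝ) - a := by
    rw [Complex.norm_real, Real.norm_eq_abs, abs_of_nonneg (by linarith)]
  rw [hnorm] at hψ
  have hlog : Real.log (1 + ((K : ℝ) - a)) ≤ (1 + ((K : ℝ) - a)) - 1 :=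
    Real.log_le_sub_one_of_pos (by linarith)
  rw [norm_mul, Complex.norm_real, Real.norm_eq_abs, abs_of_pos (Real.exp_pos _), hw, mul_comm]
  gcongr
  linarith

/-- Tail bound: for `K ≥ a + 3/4`, `‖Σ_n e^{−2t(n+K)}/((n+K) − a)‖ ≤ (4/3)·e^{−2tK}/(1 − e^{−2t})`.
[folklore] -/
private theorem norm_tail_le {t a : ℝ} (ht : 0 < t) {K : ℕ} (hK : a + 3 / 4 ≤ (K : ℝ)) :
    ‖∑' n : ℕ, ((Real.exp (-(2 * t * ((n + K : ℕ) : ℝ))) : ℝ) : ℂ) / (((n + K : ℕ) : ℂ) - a)‖ ≤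
      4 / 3 * (Real.exp (-(2 * t * K)) / (1 - Real.exp (-(2 * t)))) := by
  set q : ℝ := Real.exp (-(2 * t)) with hq
  have hq0 : 0 < q := Real.exp_pos _
  have hq1 : q < 1 := Real.exp_lt_one_iff.2 (by linarith)
  have hexp : ∀ m : ℕ, Real.exp (-(2 * t * (m : ℝ))) = q ^ m := fun m ↦ by
    rw [hq, ← Real.exp_nat_mul]; ring_nf
  have hterm : ∀ n : ℕ, ‖((Real.exp (-(2 * t * ((n + K : ℕ) : ℝ))) : ℝ) : ℂ) /
      (((n + K : ℕ) : ℂ) - a)‖ ≤ 4 / 3 * (q ^ K * q ^ n) := by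
    intro n
    have hden : 3 / 4 ≤ ‖(((n + K : ℕ) : ℂ) - a)‖ := by
      have : (((n + K : ℕ) : ℂ) - a) = (((((n + K : ℕ) : ℝ)) - a : ℝ) : ℂ) := by push_cast; ring
      rw [this, Complex.norm_real, Real.norm_eq_abs]
      have h0 : (0 : ℝ) ≤ n := n.cast_nonneg
      have : 3 / 4 ≤ (((n + K : ℕ) : ℝ)) - a := by push_cast; linarith
      exact this.trans (le_abs_self _)
    rw [norm_div, Complex.norm_real, Real.norm_eq_abs, abs_of_pos (Real.exp_pos _), hexp,
      pow_add, div_le_iff₀ (by linarith)]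
    calc q ^ n * q ^ K = 4 / 3 * (q ^ K * q ^ n) * (3 / 4) := by ring
      _ ≤ 4 / 3 * (q ^ K * q ^ n) * ‖(((n + K : ℕ) : ℂ) - a)‖ := by gcongr
  have hsum : Summable fun n : ℕ ↦ 4 / 3 * (q ^ K * q ^ n) :=
    ((summable_geometric_of_lt_one hq0.le hq1).mul_left (q ^ K)).mul_left (4 / 3)
  calc ‖∑' n : ℕ, ((Real.exp (-(2 * t * ((n + K : ℕ) : ℝ))) : ℝ) : ℂ) / (((n + K : ℕ) : ℂ) - a)‖
      ≤ ∑' n : ℕ, 4 / 3 * (q ^ K * q ^ n) :=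
        tsum_of_norm_bounded hsum.hasSum hterm
    _ = 4 / 3 * (q ^ K / (1 - q)) := by
        rw [tsum_mul_left, tsum_mul_left, tsum_geometric_of_lt_one hq0.le hq1]; ring
    _ = 4 / 3 * (Real.exp (-(2 * t * K)) / (1 - Real.exp (-(2 * t)))) := by rw [hexp K]

/-- **Main bound.** For `a ≥ 1`, `a ∉ ℕ`, with `K = ⌈a + 3/4⌉`:
`‖e^{−2ta}ψ(−a) + Σ_n e^{−2tn}/(n − a)‖ ≤ 15e^{−2ta} + 2t(a+2)e^{−2t(a−1)} + S₁/a + (4/3)e^{−2ta}/(1 − e^{−2t})`,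
`S₁ = Σ_n (n+1)e^{−2tn}`. [folklore] -/
private theorem norm_poleTerm_le {t a : ℝ} (ht : 0 < t) (ha : 1 ≤ a) (hna : ∀ n : ℕ, a ≠ n) :
    ‖((Real.exp (-(2 * t * a)) : ℝ) : ℂ) * Complex.digamma (-(a : ℂ)) +
        ∑' n : ℕ, ((Real.exp (-(2 * t * n)) : ℝ) : ℂ) / ((n : ℂ) - a)‖ ≤
      15 * Real.exp (-(2 * t * a)) + 2 * t * (a + 2) * Real.exp (-(2 * t * (a - 1))) +
        (∑' n : ℕ, ((n : ℝ) + 1) * Real.exp (-(2 * t * n))) / a +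
        4 / 3 * (Real.exp (-(2 * t * a)) / (1 - Real.exp (-(2 * t)))) := by
  set K : ℕ := ⌈a + 3 / 4⌉₊ with hK
  obtain ⟨hK1, hK2⟩ := ceil_bounds (a := a) (by linarith)
  rw [← hK] at hK1 hK2
  set f : ℕ → ℂ := fun n ↦ ((Real.exp (-(2 * t * n)) : ℝ) : ℂ) / ((n : ℂ) - a) with hf
  have hfs : Summable f := summable_exp_div_sub ht a
  -- split the series at `K`
  have hsplit := (hfs.sum_add_tsum_nat_add K).symm
  -- shift the digamma
  rw [digamma_neg_eq hna K, hsplit]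
  have hq1 : Real.exp (-(2 * t)) < 1 := Real.exp_lt_one_iff.2 (by linarith)
  -- regroup: `e^{-2ta}ψ(K-a) + Σ_{n<K} (f n - e^{-2ta}(-a+n)⁻¹) + tail`
  have hregroup : ((Real.exp (-(2 * t * a)) : ℝ) : ℂ) *
        (Complex.digamma ((K : ℂ) - a) - ∑ j ∈ Finset.range K, (-(a : ℂ) + j)⁻¹) +
        (∑ i ∈ Finset.range K, f i + ∑' i : ℕ, f (i + K)) =
      ((Real.exp (-(2 * t * a)) : ℝ) : ℂ) * Complex.digamma ((K : ℂ) - a) +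
        ∑ n ∈ Finset.range K, (f n - ((Real.exp (-(2 * t * a)) : ℝ) : ℂ) * (-(a : ℂ) + n)⁻¹) +
        ∑' i : ℕ, f (i + K) := by
    rw [Finset.sum_sub_distrib, ← Finset.mul_sum]; ring
  rw [hregroup]
  -- the three pieces
  have hA := norm_exp_mul_digamma_le (t := t) (a := a) (K := K) (by linarith) (by linarith)
  have hC : ‖∑' i : ℕ, f (i + K)‖ ≤ 4 / 3 * (Real.exp (-(2 * t * a)) / (1 - Real.exp (-(2 * t)))) := by
    have h := norm_tail_le (a := a) ht (K := K) hK1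
    have hKa : Real.exp (-(2 * t * K)) ≤ Real.exp (-(2 * t * a)) :=
      Real.exp_le_exp.2 (by nlinarith)
    have h1q : 0 < 1 - Real.exp (-(2 * t)) := by linarith
    calc ‖∑' i : ℕ, f (i + K)‖
        = ‖∑' n : ℕ, ((Real.exp (-(2 * t * ((n + K : ℕ) : ℝ))) : ℝ) : ℂ) / (((n + K : ℕ) : ℂ) - a)‖ := by
          rfl
      _ ≤ 4 / 3 * (Real.exp (-(2 * t * K)) / (1 - Real.exp (-(2 * t)))) := h
      _ ≤ 4 / 3 * (Real.exp (-(2 * t * a)) / (1 - Real.exp (-(2 * t)))) := by gcongr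
  have hB : ‖∑ n ∈ Finset.range K, (f n - ((Real.exp (-(2 * t * a)) : ℝ) : ℂ) * (-(a : ℂ) + n)⁻¹)‖ ≤
      2 * t * (a + 2) * Real.exp (-(2 * t * (a - 1))) +
        (∑' n : ℕ, ((n : ℝ) + 1) * Real.exp (-(2 * t * n))) / a := by
    -- per-term the summand is the real number `(e^{-2tn} - e^{-2ta})/(n - a)`
    have hterm : ∀ n : ℕ, f n - ((Real.exp (-(2 * t * a)) : ℝ) : ℂ) * (-(a : ℂ) + n)⁻¹ =
        (((Real.exp (-(2 * t * n)) - Real.exp (-(2 * t * a))) / ((n : ℝ) - a) : ℝ) : ℂ) := by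
      intro n
      simp only [hf]
      push_cast
      ring
    have hS1 : Summable fun n : ℕ ↦ ((n : ℝ) + 1) * Real.exp (-(2 * t * n)) := by
      have h := summable_pow_mul_geometric_of_norm_lt_one 1
        (show ‖Real.exp (-(2 * t))‖ < 1 by
          rw [Real.norm_eq_abs, abs_of_pos (Real.exp_pos _)]; exact hq1)
      have h' : Summable fun n : ℕ ↦ ((n : ℝ) ^ 1 + 1) * Real.exp (-(2 * t)) ^ n :=
        (h.add (summable_geometric_of_lt_one (Real.exp_pos _).le hq1)).congr
          (fun n ↦ by ring)
      refine h'.congr fun n ↦ ?_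
      rw [pow_one, ← Real.exp_nat_mul]; ring_nf
    calc ‖∑ n ∈ Finset.range K, (f n - ((Real.exp (-(2 * t * a)) : ℝ) : ℂ) * (-(a : ℂ) + n)⁻¹)‖
        ≤ ∑ n ∈ Finset.range K, ‖f n - ((Real.exp (-(2 * t * a)) : ℝ) : ℂ) * (-(a : ℂ) + n)⁻¹‖ :=
          norm_sum_le _ _
      _ ≤ ∑ n ∈ Finset.range K, (((n : ℝ) + 1) * Real.exp (-(2 * t * n)) / a +
            2 * t * Real.exp (-(2 * t * (a - 1)))) := by
          refine Finset.sum_le_sum fun n _ ↦ ?_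
          rw [hterm, Complex.norm_real, Real.norm_eq_abs]
          exact abs_head_term_le ht ha (hna n)
      _ = (∑ n ∈ Finset.range K, ((n : ℝ) + 1) * Real.exp (-(2 * t * n))) / a +
            K * (2 * t * Real.exp (-(2 * t * (a - 1)))) := by
          rw [Finset.sum_add_distrib, Finset.sum_div, Finset.sum_const, Finset.card_range,
            nsmul_eq_mul]
      _ ≤ (∑' n : ℕ, ((n : ℝ) + 1) * Real.exp (-(2 * t * n))) / a +
            (a + 2) * (2 * t * Real.exp (-(2 * t * (a - 1)))) := by
          gcongr
          · exact hS1.sum_le_tsum _ (fun n _ ↦ by positivity)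
          · linarith
      _ = _ := by ring
  calc _ ≤ ‖((Real.exp (-(2 * t * a)) : ℝ) : ℂ) * Complex.digamma ((K : ℂ) - a) +
          ∑ n ∈ Finset.range K, (f n - ((Real.exp (-(2 * t * a)) : ℝ) : ℂ) * (-(a : ℂ) + n)⁻¹)‖ +
          ‖∑' i : ℕ, f (i + K)‖ := norm_add_le _ _
    _ ≤ (‖((Real.exp (-(2 * t * a)) : ℝ) : ℂ) * Complex.digamma ((K : ℂ) - a)‖ +
          ‖∑ n ∈ Finset.range K, (f n - ((Real.exp (-(2 * t * a)) : ℝ) : ℂ) * (-(a : ℂ) + n)⁻¹)‖) +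
          ‖∑' i : ℕ, f (i + K)‖ := by gcongr; exact norm_add_le _ _
    _ ≤ (15 * Real.exp (-(2 * t * a)) + (2 * t * (a + 2) * Real.exp (-(2 * t * (a - 1))) +
          (∑' n : ℕ, ((n : ℝ) + 1) * Real.exp (-(2 * t * n))) / a)) +
          4 / 3 * (Real.exp (-(2 * t * a)) / (1 - Real.exp (-(2 * t)))) := by
        gcongr
    _ = _ := by ring

/-- The majorant tends to `0` as `a → +∞`. [folklore] -/
private theorem tendsto_majorant {t : ℝ} (ht : 0 < t) :
    Tendsto (fun a : ℝ ↦ 15 * Real.exp (-(2 * t * a)) + 2 * t * (a + 2) * Real.exp (-(2 * t * (a - 1))) +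
        (∑' n : ℕ, ((n : ℝ) + 1) * Real.exp (-(2 * t * n))) / a +
        4 / 3 * (Real.exp (-(2 * t * a)) / (1 - Real.exp (-(2 * t))))) atTop (𝓝 0) := by
  -- `e^{-2ta} → 0`
  have h2t : Tendsto (fun a : ℝ ↦ 2 * t * a) atTop atTop :=
    tendsto_id.const_mul_atTop (by linarith)
  have hexp : Tendsto (fun a : ℝ ↦ Real.exp (-(2 * t * a))) atTop (𝓝 0) :=
    Real.tendsto_exp_neg_atTop_nhds_zero.comp h2t
  -- `a e^{-2ta} → 0`
  have haexp : Tendsto (fun a : ℝ ↦ a * Real.exp (-(2 * t * a))) atTop (𝓝 0) := by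
    have h := (Real.tendsto_pow_mul_exp_neg_atTop_nhds_zero 1).comp h2t
    have h' := h.const_mul (1 / (2 * t))
    rw [mul_zero] at h'
    refine h'.congr fun a ↦ ?_
    simp only [Function.comp_def, pow_one]
    field_simp
  have h1 : Tendsto (fun a : ℝ ↦ 15 * Real.exp (-(2 * t * a))) atTop (𝓝 0) := by
    simpa using hexp.const_mul 15
  have h2 : Tendsto (fun a : ℝ ↦ 2 * t * (a + 2) * Real.exp (-(2 * t * (a - 1)))) atTop (𝓝 0) := by
    have h := ((haexp.add (hexp.const_mul 2)).const_mul (2 * t * Real.exp (2 * t)))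
    rw [mul_zero, add_zero, mul_zero] at h
    refine h.congr fun a ↦ ?_
    have : Real.exp (-(2 * t * (a - 1))) = Real.exp (2 * t) * Real.exp (-(2 * t * a)) := by
      rw [← Real.exp_add]; ring_nf
    rw [this]; ring
  have h3 : Tendsto (fun a : ℝ ↦ (∑' n : ℕ, ((n : ℝ) + 1) * Real.exp (-(2 * t * n))) / a)
      atTop (𝓝 0) := tendsto_const_nhds.div_atTop tendsto_id
  have h4 : Tendsto (fun a : ℝ ↦ 4 / 3 * (Real.exp (-(2 * t * a)) / (1 - Real.exp (-(2 * t)))))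
      atTop (𝓝 0) := by
    simpa using (hexp.div_const (1 - Real.exp (-(2 * t)))).const_mul (4 / 3)
  simpa using ((h1.add h2).add h3).add h4

/-- **The pole-cancellation term vanishes in the limit**: along `a → +∞`, `a ∉ ℕ`,
`e^{−2ta} ψ(−a) + Σ_n e^{−2tn}/(n − a) → 0`. [folklore] -/
private theorem tendsto_poleTerm {t : ℝ} (ht : 0 < t) :
    Tendsto (fun a : ℝ ↦ ((Real.exp (-(2 * t * a)) : ℝ) : ℂ) * Complex.digamma (-(a : ℂ)) +
        ∑' n : ℕ, ((Real.exp (-(2 * t * n)) : ℝ) : ℂ) / ((n : ℂ) - a))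
      (atTop ⊓ 𝓟 {a : ℝ | ∀ n : ℕ, a ≠ n}) (𝓝 0) := by
  refine squeeze_zero_norm' ?_ ((tendsto_majorant ht).mono_left inf_le_left)
  have h1 : ∀ᶠ a : ℝ in atTop ⊓ 𝓟 {a : ℝ | ∀ n : ℕ, a ≠ n}, 1 ≤ a :=
    (eventually_ge_atTop (1 : ℝ)).filter_mono inf_le_left
  have h2 : ∀ᶠ a : ℝ in atTop ⊓ 𝓟 {a : ℝ | ∀ n : ℕ, a ≠ n}, ∀ n : ℕ, a ≠ n :=
    mem_inf_of_right (mem_principal_self _)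
  filter_upwards [h1, h2] with a ha hna
  exact norm_poleTerm_le ht ha hna


/-! ## §3. The derivative of `Ψ = zetaScrew` off `log ℕ` -/


/-- `Σ_k e^{−(2k+½)s}` converges for `s > 0`. [folklore] -/
private theorem summable_exp_lam {s : ℝ} (hs : 0 < s) :
    Summable fun k : ℕ ↦ Real.exp (-((2 * k + 1 / 2) * s)) := by
  have hq : Real.exp (-(2 * s)) < 1 := Real.exp_lt_one_iff.2 (by linarith)
  refine (summable_geometric_of_lt_one (Real.exp_pos _).le hq).of_nonneg_of_le
    (fun k ↦ (Real.exp_pos _).le) (fun k ↦ ?_)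
  rw [← Real.exp_nat_mul, Real.exp_le_exp]
  have hk : (0 : ℝ) ≤ k := k.cast_nonneg
  nlinarith

/-- Termwise derivative: `d/dy e^{−(2k+½)y}/(k+¼)² = −2e^{−(2k+½)y}/(k+¼)`. [folklore] -/
private theorem hasDerivAt_lerch_term (k : ℕ) (y : ℝ) :
    HasDerivAt (fun y : ℝ ↦ Real.exp (-((2 * k + 1 / 2) * y)) / ((k : ℝ) + 1 / 4) ^ 2)
      (-2 * (Real.exp (-((2 * k + 1 / 2) * y)) / ((k : ℝ) + 1 / 4))) y := by
  have hk : (0 : ℝ) ≤ k := k.cast_nonneg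
  have hne : ((k : ℝ) + 1 / 4) ≠ 0 := by positivity
  have h1 : HasDerivAt (fun y : ℝ ↦ -((2 * k + 1 / 2) * y)) (-((2 * k + 1 / 2) * 1)) y :=
    ((hasDerivAt_id' y).const_mul _).fun_neg
  have h2 : HasDerivAt (fun y : ℝ ↦ Real.exp (-((2 * k + 1 / 2) * y)))
      (Real.exp (-((2 * k + 1 / 2) * y)) * (-((2 * k + 1 / 2) * 1))) y :=
    (Real.hasDerivAt_exp _).comp y h1
  refine (h2.div_const (((k : ℝ) + 1 / 4) ^ 2)).congr_deriv ?_
  field_simp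
  ring

/-- **Termwise differentiation of the Hurwitz–Lerch term**: for `t > 0`,
`d/dt Σ_k e^{−(2k+½)t}/(k+¼)² = Σ_k −2e^{−(2k+½)t}/(k+¼)`. [folklore] -/
private theorem hasDerivAt_lerch_tsum {t : ℝ} (ht : 0 < t) :
    HasDerivAt (fun y : ℝ ↦ ∑' k : ℕ, Real.exp (-((2 * k + 1 / 2) * y)) / ((k : ℝ) + 1 / 4) ^ 2)
      (∑' k : ℕ, -2 * (Real.exp (-((2 * k + 1 / 2) * t)) / ((k : ℝ) + 1 / 4))) t := by
  have hδ0 : 0 < t / 2 := by positivity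
  have hu : Summable fun k : ℕ ↦ 8 * Real.exp (-((2 * k + 1 / 2) * (t / 2))) :=
    (summable_exp_lam hδ0).mul_left 8
  have hg0 : Summable fun k : ℕ ↦ Real.exp (-((2 * k + 1 / 2) * t)) / ((k : ℝ) + 1 / 4) ^ 2 := by
    refine ((summable_exp_lam ht).mul_left 16).of_nonneg_of_le (fun k ↦ by positivity) (fun k ↦ ?_)
    have hk : (0 : ℝ) ≤ k := k.cast_nonneg
    rw [div_eq_mul_inv, mul_comm]
    refine mul_le_mul_of_nonneg_right ?_ (Real.exp_pos _).le
    rw [inv_le_comm₀ (by positivity) (by norm_num)]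
    nlinarith
  refine hasDerivAt_tsum_of_isPreconnected (𝕜 := ℝ) (F := ℝ) (t := Set.Ioi (t / 2)) (y₀ := t)
    (g := fun (k : ℕ) (y : ℝ) ↦ Real.exp (-((2 * k + 1 / 2) * y)) / ((k : ℝ) + 1 / 4) ^ 2)
    (g' := fun (k : ℕ) (y : ℝ) ↦ -2 * (Real.exp (-((2 * k + 1 / 2) * y)) / ((k : ℝ) + 1 / 4)))
    hu isOpen_Ioi (convex_Ioi (t / 2)).isPreconnected (fun k y _ ↦ hasDerivAt_lerch_term k y) ?_
    (by simp only [Set.mem_Ioi]; linarith) hg0 (by simp only [Set.mem_Ioi]; linarith)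
  intro k y hy
  simp only [Set.mem_Ioi] at hy
  have hk : (0 : ℝ) ≤ k := k.cast_nonneg
  rw [norm_mul, norm_neg, Real.norm_eq_abs, Real.norm_eq_abs, abs_of_pos (by norm_num : (0:ℝ) < 2),
    abs_of_nonneg (by positivity), div_eq_mul_inv]
  have hexp : Real.exp (-((2 * k + 1 / 2) * y)) ≤ Real.exp (-((2 * k + 1 / 2) * (t / 2))) :=
    Real.exp_le_exp.mpr (by nlinarith)
  have hinv : (((k : ℝ) + 1 / 4))⁻¹ ≤ 4 := by
    rw [inv_le_comm₀ (by positivity) (by norm_num)]; linarith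
  calc 2 * (Real.exp (-((2 * k + 1 / 2) * y)) * ((k : ℝ) + 1 / 4)⁻¹)
      ≤ 2 * (Real.exp (-((2 * k + 1 / 2) * (t / 2))) * 4) := by
        gcongr
    _ = 8 * Real.exp (-((2 * k + 1 / 2) * (t / 2))) := by ring

/-- For `t > 0`, `t ∉ log ℕ`: near `t` the floor `⌊e^{s}⌋` is constant and `|s| = s`, so `Ψ` agrees
with a smooth closed expression. [folklore] -/
private theorem zetaScrew_eventuallyEq {t : ℝ} (ht : 0 < t) (hlog : ∀ n : ℕ, t ≠ Real.log n) :
    zetaScrew =ᶠ[𝓝 t] fun s ↦ 4 * (Real.exp (s / 2) + Real.exp (-(s / 2)) - 2)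
      - (∑ n ∈ Finset.Icc 1 ⌊Real.exp t⌋₊,
          ArithmeticFunction.vonMangoldt n / Real.sqrt n * (s - Real.log n))
      - s / 2 * (Real.eulerMascheroniConstant + Real.pi / 2 + 3 * Real.log 2 + Real.log Real.pi)
      + (1 / 4) * ((∑' k : ℕ, 1 / ((k : ℝ) + 1 / 4) ^ 2)
          - ∑' k : ℕ, Real.exp (-((2 * k + 1 / 2) * s)) / ((k : ℝ) + 1 / 4) ^ 2) := by
  set m : ℕ := ⌊Real.exp t⌋₊ with hm
  have hm1 : (m : ℝ) < Real.exp t := by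
    refine lt_of_le_of_ne (Nat.floor_le (Real.exp_pos t).le) fun h ↦ ?_
    have h1 : (1 : ℝ) < Real.exp t := by
      have := Real.add_one_le_exp t; linarith
    have hm0 : 0 < m := by
      have : (0 : ℝ) < m := by rw [h]; exact Real.exp_pos t
      exact_mod_cast this
    apply hlog m
    rw [h, Real.log_exp]
  have hm2 : Real.exp t < m + 1 := Nat.lt_floor_add_one _
  have hev : ∀ᶠ s in 𝓝 t, 0 < s ∧ (m : ℝ) < Real.exp s ∧ Real.exp s < m + 1 := by
    have hc : ContinuousAt Real.exp t := Real.continuous_exp.continuousAt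
    filter_upwards [(isOpen_lt continuous_const continuous_id).mem_nhds ht,
      hc.preimage_mem_nhds (isOpen_Ioo.mem_nhds ⟨hm1, hm2⟩)] with s hs hs'
    exact ⟨hs, hs'.1, hs'.2⟩
  filter_upwards [hev] with s ⟨hs0, hsm1, hsm2⟩
  have habs : |s| = s := abs_of_pos hs0
  have hfloor : ⌊Real.exp s⌋₊ = m := by
    rw [Nat.floor_eq_iff (Real.exp_pos s).le]
    exact ⟨hsm1.le, hsm2⟩
  have htsum : Real.exp (-(s / 2)) * ∑' k : ℕ, Real.exp (-(2 * s * k)) / ((k : ℝ) + 1 / 4) ^ 2 =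
      ∑' k : ℕ, Real.exp (-((2 * k + 1 / 2) * s)) / ((k : ℝ) + 1 / 4) ^ 2 := by
    rw [← tsum_mul_left]
    refine tsum_congr fun k ↦ ?_
    rw [mul_div_assoc', ← Real.exp_add]
    ring_nf
  rw [zetaScrew_def, habs, hfloor, htsum]

/-- **`Ψ′(t)` for `t > 0`, `t ≠ log n`**:
`Ψ′(t) = 2(e^{t/2} − e^{−t/2}) − Σ_{n ≤ e^t} Λ(n)n^{−1/2} − ½(γ₀ + π/2 + 3log 2 + log π) + ½e^{−t/2}Φ(e^{−2t},1,¼)`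
(termwise differentiation of (1.1); the printed `(d/dt)(e^{−t/2}Φ(e^{−2t},2,¼)) = −2e^{−t/2}Φ(e^{−2t},2,¼)`
should read `Φ(e^{−2t},1,¼)` on the right). [cite: Suzuki2025WeilHilbertSpace, §7 proof of Thm 7.1 (TeX l.2222–2226)] -/
theorem hasDerivAt_zetaScrew_of_pos {t : ℝ} (ht : 0 < t) (hlog : ∀ n : ℕ, t ≠ Real.log n) :
    HasDerivAt zetaScrew
      (2 * (Real.exp (t / 2) - Real.exp (-(t / 2)))
        - (∑ n ∈ Finset.Icc 1 ⌊Real.exp t⌋₊, ArithmeticFunction.vonMangoldt n / Real.sqrt n)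
        - (Real.eulerMascheroniConstant + Real.pi / 2 + 3 * Real.log 2 + Real.log Real.pi) / 2
        + 1 / 2 * Real.exp (-(t / 2)) * ∑' k : ℕ, Real.exp (-(2 * t * k)) / ((k : ℝ) + 1 / 4)) t := by
  refine HasDerivAt.congr_of_eventuallyEq ?_ (zetaScrew_eventuallyEq ht hlog)
  have hA : HasDerivAt (fun s : ℝ ↦ 4 * (Real.exp (s / 2) + Real.exp (-(s / 2)) - 2))
      (4 * (Real.exp (t / 2) * (1 / 2) + Real.exp (-(t / 2)) * (-(1 / 2)))) t := by
    have h1 : HasDerivAt (fun s : ℝ ↦ Real.exp (s / 2)) (Real.exp (t / 2) * (1 / 2)) t :=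
      (Real.hasDerivAt_exp _).comp t ((hasDerivAt_id' t).div_const 2)
    have h2 : HasDerivAt (fun s : ℝ ↦ Real.exp (-(s / 2))) (Real.exp (-(t / 2)) * (-(1 / 2))) t :=
      (Real.hasDerivAt_exp _).comp t ((hasDerivAt_id' t).div_const 2).fun_neg
    exact ((h1.add h2).sub_const 2).const_mul 4
  have hP : HasDerivAt (fun s : ℝ ↦ ∑ n ∈ Finset.Icc 1 ⌊Real.exp t⌋₊,
      ArithmeticFunction.vonMangoldt n / Real.sqrt n * (s - Real.log n))
      (∑ n ∈ Finset.Icc 1 ⌊Real.exp t⌋₊, ArithmeticFunction.vonMangoldt n / Real.sqrt n * 1) t :=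
    HasDerivAt.fun_sum fun n _ ↦ ((hasDerivAt_id' t).sub_const _).const_mul _
  have hL : HasDerivAt (fun s : ℝ ↦ s / 2 *
      (Real.eulerMascheroniConstant + Real.pi / 2 + 3 * Real.log 2 + Real.log Real.pi))
      (1 / 2 * (Real.eulerMascheroniConstant + Real.pi / 2 + 3 * Real.log 2 + Real.log Real.pi)) t :=
    ((hasDerivAt_id' t).div_const 2).mul_const _
  have hH : HasDerivAt (fun s : ℝ ↦ (1 / 4) * ((∑' k : ℕ, 1 / ((k : ℝ) + 1 / 4) ^ 2)
      - ∑' k : ℕ, Real.exp (-((2 * k + 1 / 2) * s)) / ((k : ℝ) + 1 / 4) ^ 2))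
      ((1 / 4) * (0 - ∑' k : ℕ, -2 * (Real.exp (-((2 * k + 1 / 2) * t)) / ((k : ℝ) + 1 / 4)))) t :=
    ((hasDerivAt_const t _).sub (hasDerivAt_lerch_tsum ht)).const_mul _
  refine (((hA.sub hP).sub hL).add hH).congr_deriv ?_
  have htsum : ∑' k : ℕ, -2 * (Real.exp (-((2 * k + 1 / 2) * t)) / ((k : ℝ) + 1 / 4)) =
      -2 * (Real.exp (-(t / 2)) * ∑' k : ℕ, Real.exp (-(2 * t * k)) / ((k : ℝ) + 1 / 4)) := by
    rw [tsum_mul_left, ← tsum_mul_left (a := Real.exp (-(t / 2)))]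
    congr 1
    refine tsum_congr fun k ↦ ?_
    rw [mul_div_assoc', ← Real.exp_add]
    ring_nf
  rw [htsum]
  simp only [mul_one]
  ring


/-! ## §4. Scalar limits and the unfolded form of `y·𝔓_t(−iy)` -/


/-! ### Scalar limits as `y → +∞` -/

/-- `1/(1+2y) → 0`. [folklore] -/
private theorem tendsto_inv_one_add : Tendsto (fun y : ℝ ↦ (1 : ℝ) / (1 + 2 * y)) atTop (𝓝 0) :=
  tendsto_const_nhds.div_atTop
    (tendsto_atTop_add_const_left _ _ (tendsto_id.const_mul_atTop two_pos))

/-- `1/(1−2y) → 0`. [folklore] -/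
private theorem tendsto_inv_one_sub : Tendsto (fun y : ℝ ↦ (1 : ℝ) / (1 - 2 * y)) atTop (𝓝 0) := by
  have h : Tendsto (fun y : ℝ ↦ 1 + -(2 * y)) atTop atBot :=
    tendsto_atBot_add_const_left _ _ (tendsto_neg_atTop_atBot.comp (tendsto_id.const_mul_atTop two_pos))
  have h' := (tendsto_const_nhds (x := (1 : ℝ))).div_atBot h
  refine h'.congr fun y ↦ ?_
  show (1 : ℝ) / (1 + -(2 * y)) = 1 / (1 - 2 * y)
  ring

/-- `e^{−ys} → 0` for `s > 0`. [folklore] -/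
private theorem tendsto_exp_neg_mul {s : ℝ} (hs : 0 < s) :
    Tendsto (fun y : ℝ ↦ Real.exp (-(y * s))) atTop (𝓝 0) :=
  Real.tendsto_exp_neg_atTop_nhds_zero.comp (tendsto_id.atTop_mul_const hs)

/-- `y e^{−ys} → 0` for `s > 0`. [folklore] -/
private theorem tendsto_mul_exp_neg_mul {s : ℝ} (hs : 0 < s) :
    Tendsto (fun y : ℝ ↦ y * Real.exp (-(y * s))) atTop (𝓝 0) := by
  have h := (Real.tendsto_pow_mul_exp_neg_atTop_nhds_zero 1).comp (tendsto_id.atTop_mul_const hs)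
  have h' := h.const_mul (1 / s)
  rw [mul_zero] at h'
  refine h'.congr fun y ↦ ?_
  simp only [Function.comp_def, pow_one, id]
  field_simp

/-- `ζ′/ζ(½ + y) → 0` (`|ζ′/ζ(σ)| < 1/(σ−1)`). [folklore] -/
private theorem tendsto_logDerivZeta_half_add :
    Tendsto (fun y : ℝ ↦ deriv riemannZeta (1 / 2 + (y : ℂ)) / riemannZeta (1 / 2 + (y : ℂ)))
      atTop (𝓝 0) := by
  have hb : Tendsto (fun y : ℝ ↦ (1 : ℝ) / (y - 1 / 2)) atTop (𝓝 0) :=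
    tendsto_const_nhds.div_atTop (tendsto_atTop_add_const_right _ _ tendsto_id)
  refine squeeze_zero_norm' ?_ hb
  filter_upwards [eventually_ge_atTop (1 : ℝ)] with y hy
  have hre : 1 < (1 / 2 + (y : ℂ)).re := by simp; linarith
  have h := norm_deriv_riemannZeta_div_lt hre
  have : (1 / 2 + (y : ℂ)).re - 1 = y - 1 / 2 := by simp; ring
  rw [this] at h
  exact h.le

/-- `e^{−yt} ψ(¼ + y/2) → 0` for `t > 0` (`|ψ(w)| ≤ log(1+|w|) + 13` on `Re w ≥ ¾`). [folklore] -/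
private theorem tendsto_exp_mul_digamma {t : ℝ} (ht : 0 < t) :
    Tendsto (fun y : ℝ ↦ ((Real.exp (-(y * t)) : ℝ) : ℂ) * Complex.digamma (1 / 4 + (y : ℂ) / 2))
      atTop (𝓝 0) := by
  have hb : Tendsto (fun y : ℝ ↦ Real.exp (-(y * t)) * (y + 14)) atTop (𝓝 0) := by
    have h := (tendsto_mul_exp_neg_mul ht).add ((tendsto_exp_neg_mul ht).const_mul 14)
    rw [mul_zero, add_zero] at h
    exact h.congr fun y ↦ by ring
  refine squeeze_zero_norm' ?_ hb
  filter_upwards [eventually_ge_atTop (1 : ℝ)] with y hy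
  have hw : ((1 : ℂ) / 4 + (y : ℂ) / 2) = (((1 / 4 + y / 2 : ℝ)) : ℂ) := by push_cast; ring
  have hre : (3 : ℝ) / 4 ≤ ((1 : ℂ) / 4 + (y : ℂ) / 2).re := by rw [hw, Complex.ofReal_re]; linarith
  have hψ := SmoothedEF.norm_digamma_le_log_uniform hre
  have hnorm : ‖((1 : ℂ) / 4 + (y : ℂ) / 2)‖ = 1 / 4 + y / 2 := by
    rw [hw, Complex.norm_real, Real.norm_eq_abs, abs_of_pos (by linarith)]
  rw [hnorm] at hψ
  have hlog : Real.log (1 + (1 / 4 + y / 2)) ≤ (1 + (1 / 4 + y / 2)) - 1 :=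
    Real.log_le_sub_one_of_pos (by linarith)
  rw [norm_mul, Complex.norm_real, Real.norm_eq_abs, abs_of_pos (Real.exp_pos _)]
  gcongr
  linarith

/-! ### The unfolded form of `y · 𝔓_t(−iy)` -/

/-- `Σ_n e^{−2tn}/(n + ¼)` converges. [folklore] -/
private theorem summable_exp_mul_inv_quarter (t : ℝ) (ht : 0 < t) :
    Summable fun n : ℕ ↦ ((Real.exp (-(2 * t * n)) : ℝ) : ℂ) * (1 / ((n : ℂ) + 1 / 4)) := by
  have hq1 : Real.exp (-(2 * t)) < 1 := Real.exp_lt_one_iff.2 (by linarith)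
  refine Summable.of_norm_bounded ((summable_geometric_of_lt_one (Real.exp_pos _).le hq1).mul_left 4)
    fun n ↦ ?_
  have hk : (0 : ℝ) ≤ n := n.cast_nonneg
  have hq : ((n : ℂ) + 1 / 4) = (((n : ℝ) + 1 / 4 : ℝ) : ℂ) := by push_cast; ring
  rw [norm_mul, Complex.norm_real, Real.norm_eq_abs, abs_of_pos (Real.exp_pos _), hq, norm_div,
    norm_one, Complex.norm_real, Real.norm_eq_abs, abs_of_pos (by positivity),
    show -(2 * t * (n : ℝ)) = (n : ℝ) * (-(2 * t)) by ring, Real.exp_nat_mul]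
  rw [mul_comm (4 : ℝ)]
  gcongr
  rw [div_le_iff₀ (by positivity)]
  linarith

/-- The Hurwitz–Lerch bracket at `z = −iy` splits: `B(t, −iy) = Σ e^{−2tn}/(n − a) − Σ e^{−2tn}/(n + ¼)`,
`a = y/2 − ¼` (`t > 0`). [folklore] -/
private theorem screwLerchBracket_neg_I_mul {t : ℝ} (ht : 0 < t) (y : ℝ) :
    screwLerchBracket t (-(I * y)) =
      (∑' n : ℕ, ((Real.exp (-(2 * t * n)) : ℝ) : ℂ) / ((n : ℂ) - (((y / 2 - 1 / 4 : ℝ)) : ℂ))) -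
        ∑' n : ℕ, ((Real.exp (-(2 * t * n)) : ℝ) : ℂ) * (1 / ((n : ℂ) + 1 / 4)) := by
  unfold screwLerchBracket
  rw [abs_of_pos ht, ← (summable_exp_div_sub ht _).tsum_sub (summable_exp_mul_inv_quarter t ht)]
  refine tsum_congr fun n ↦ ?_
  have hIz : ((n : ℂ) + (1 / 2 - I * -(I * (y : ℂ))) / 2) = ((n : ℂ) - (((y / 2 - 1 / 4 : ℝ)) : ℂ)) := by
    push_cast
    ring_nf
    rw [Complex.I_sq]
    ring
  rw [hIz]
  ring

/-- **Unfolding `y · 𝔓_t(−iy)`** for `t > 0`, `y ≥ 1`, `y ∉ 2ℕ + ½`, with the functional equation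
substituted for `ζ′/ζ(½ − y)` and the Lerch bracket split. [folklore] -/
private theorem main_identity {t y : ℝ} (ht : 0 < t) (hy : 1 ≤ y) (hS : ∀ n : ℕ, y ≠ 2 * n + 1 / 2) :
    (y : ℂ) * screwP t (-(I * y)) - 1 / 2 * Complex.digamma (1 / 4 + (y : ℂ) / 2) +
        1 / 2 * (Real.log Real.pi : ℂ) =
      (2 * ((Real.exp (t / 2) - 1 : ℝ) : ℂ) -
          2 * ((Real.exp (t / 2) - 1 : ℝ) : ℂ) * (((1 / (1 + 2 * y) : ℝ)) : ℂ)) +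
      (-(2 * ((Real.exp (-(t / 2)) - 1 : ℝ) : ℂ)) +
          2 * ((Real.exp (-(t / 2)) - 1 : ℝ) : ℂ) * (((1 / (1 - 2 * y) : ℝ)) : ℂ)) +
      (1 - ((Real.exp (-(y * t)) : ℝ) : ℂ)) *
          (deriv riemannZeta (1 / 2 + (y : ℂ)) / riemannZeta (1 / 2 + (y : ℂ))) +
      (((Real.exp (-(y * t)) : ℝ) : ℂ) * (Real.log Real.pi : ℂ) -
          1 / 2 * (((Real.exp (-(y * t)) : ℝ) : ℂ) * Complex.digamma (1 / 4 + (y : ℂ) / 2)) -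
          1 / 2 * (Real.log Real.pi : ℂ)) +
      (∑ n ∈ Finset.Icc 1 ⌊Real.exp t⌋₊,
          ((ArithmeticFunction.vonMangoldt n / Real.sqrt n : ℝ) : ℂ) *
            (((Real.exp (-(y * (t - Real.log n))) : ℝ) : ℂ) - 1)) +
      (1 / 2 * Complex.digamma (1 / 4) +
          1 / 2 * ((Real.exp (-(t / 2)) : ℝ) : ℂ) *
            ∑' n : ℕ, ((Real.exp (-(2 * t * n)) : ℝ) : ℂ) * (1 / ((n : ℂ) + 1 / 4))) +
      (-(1 / 2) * (((Real.exp (-(y * t)) : ℝ) : ℂ) * Complex.digamma (1 / 4 - (y : ℂ) / 2) +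
          ((Real.exp (-(t / 2)) : ℝ) : ℂ) *
            ∑' n : ℕ, ((Real.exp (-(2 * t * n)) : ℝ) : ℂ) / ((n : ℂ) - (((y / 2 - 1 / 4 : ℝ)) : ℂ)))) := by
  have hIz : I * -(I * (y : ℂ)) = y := by
    ring_nf; rw [Complex.I_sq]; ring
  have h2Iz : 2 * I * -(I * (y : ℂ)) = 2 * y := by
    ring_nf; rw [Complex.I_sq]; ring
  have hy0 : (y : ℂ) ≠ 0 := by exact_mod_cast (show y ≠ 0 by linarith)
  have h1y : (1 : ℂ) + 2 * y ≠ 0 := by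
    intro h; have := congrArg Complex.re h; simp at this; linarith
  have h2y : (1 : ℂ) - 2 * y ≠ 0 := by
    intro h; have := congrArg Complex.re h; simp at this; linarith
  have hFE := logDeriv_zeta_half_sub (y := y) (by linarith) hS
  have hbr := screwLerchBracket_neg_I_mul ht y
  -- atoms
  set Zp := deriv riemannZeta (1 / 2 + (y : ℂ)) / riemannZeta (1 / 2 + (y : ℂ)) with hZp
  set ψp := Complex.digamma (1 / 4 + (y : ℂ) / 2) with hψp
  set ψm := Complex.digamma (1 / 4 - (y : ℂ) / 2) with hψm
  set ψ0 := Complex.digamma (1 / 4) with hψ0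
  set Sa := ∑' n : ℕ, ((Real.exp (-(2 * t * n)) : ℝ) : ℂ) / ((n : ℂ) - (((y / 2 - 1 / 4 : ℝ)) : ℂ))
    with hSa
  set S0 := ∑' n : ℕ, ((Real.exp (-(2 * t * n)) : ℝ) : ℂ) * (1 / ((n : ℂ) + 1 / 4)) with hS0
  set Lπ := (Real.log Real.pi : ℂ) with hLπ
  -- unfold `𝔓_t(−iy)`
  have hP : screwP t (-(I * y)) =
      4 * ((Real.exp (t / 2) - 1 : ℝ) : ℂ) / (1 + 2 * y) +
      4 * ((Real.exp (-(t / 2)) - 1 : ℝ) : ℂ) / (1 - 2 * y) +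
      (((Real.exp (-(y * t)) : ℝ) : ℂ) - 1) / y * (-Zp + Lπ - ψp / 2 - ψm / 2) +
      (∑ n ∈ Finset.Icc 1 ⌊Real.exp t⌋₊,
          ((ArithmeticFunction.vonMangoldt n / Real.sqrt n : ℝ) : ℂ) *
            (((Real.exp (-(y * (t - Real.log n))) : ℝ) : ℂ) - 1)) / y -
      1 / (2 * y) * (ψm - ψ0) -
      1 / (2 * y) * ((Real.exp (-(t / 2)) : ℝ) : ℂ) * (Sa - S0) := by
    rw [screwP, abs_of_pos ht, hbr]
    simp only [hIz, h2Iz]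
    rw [hFE]
    have hE1 : cexp (-((y : ℂ) * (t : ℂ))) = ((Real.exp (-(y * t)) : ℝ) : ℂ) := by
      rw [Complex.ofReal_exp]; push_cast; ring_nf
    have hsum : (∑ n ∈ Finset.Icc 1 ⌊Real.exp t⌋₊,
        ((ArithmeticFunction.vonMangoldt n / Real.sqrt n : ℝ) : ℂ) *
          ((cexp (-((y : ℂ) * ((t - Real.log n : ℝ) : ℂ))) - 1) / (y : ℂ))) =
        (∑ n ∈ Finset.Icc 1 ⌊Real.exp t⌋₊,
          ((ArithmeticFunction.vonMangoldt n / Real.sqrt n : ℝ) : ℂ) *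
            (((Real.exp (-(y * (t - Real.log n))) : ℝ) : ℂ) - 1)) / y := by
      rw [Finset.sum_div]
      refine Finset.sum_congr rfl fun n _ ↦ ?_
      rw [Complex.ofReal_exp]
      push_cast
      ring
    rw [hE1, hsum]
  rw [hP]
  push_cast
  set u : ℂ := (1 : ℂ) + 2 * y with hu
  set v : ℂ := (1 : ℂ) - 2 * y with hv
  field_simp
  rw [hu, hv]
  ring


/-! ## §5. The limit (7.2) and the discharge -/

/-- The pole term of `main_identity` tends to `0` along `y → +∞`, `y ∉ 2ℕ + ½`
(`tendsto_poleTerm` at `a = y/2 − ¼`, `e^{−t/2}e^{−2ta} = e^{−yt}`). [folklore] -/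
private theorem tendsto_poleTerm_y {t : ℝ} (ht : 0 < t) :
    Tendsto (fun y : ℝ ↦ -(1 / 2 : ℂ) * (((Real.exp (-(y * t)) : ℝ) : ℂ) *
        Complex.digamma (1 / 4 - (y : ℂ) / 2) +
        ((Real.exp (-(t / 2)) : ℝ) : ℂ) *
          ∑' n : ℕ, ((Real.exp (-(2 * t * n)) : ℝ) : ℂ) / ((n : ℂ) - (((y / 2 - 1 / 4 : ℝ)) : ℂ))))
      (atTop ⊓ 𝓟 {y : ℝ | ∀ n : ℕ, y ≠ 2 * n + 1 / 2}) (𝓝 0) := by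
  have ha : Tendsto (fun y : ℝ ↦ y / 2 - 1 / 4) (atTop ⊓ 𝓟 {y : ℝ | ∀ n : ℕ, y ≠ 2 * n + 1 / 2})
      (atTop ⊓ 𝓟 {a : ℝ | ∀ n : ℕ, a ≠ n}) := by
    refine Tendsto.inf ?_ (tendsto_principal_principal.2 ?_)
    · have h : Tendsto (fun y : ℝ ↦ y / 2 + -(1 / 4)) atTop atTop :=
        tendsto_atTop_add_const_right _ _ (tendsto_id.atTop_div_const (by norm_num))
      exact h.congr fun y ↦ by ring
    · intro y hy n h
      exact hy n (by linarith)
  have h := ((tendsto_poleTerm ht).comp ha).const_mul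
    (-(1 / 2 : ℂ) * ((Real.exp (-(t / 2)) : ℝ) : ℂ))
  rw [mul_zero] at h
  refine h.congr' (Eventually.of_forall fun y ↦ ?_)
  simp only [Function.comp_def]
  have hψ : Complex.digamma (-(((y / 2 - 1 / 4 : ℝ)) : ℂ)) = Complex.digamma (1 / 4 - (y : ℂ) / 2) := by
    congr 1; push_cast; ring
  have hexp : ((Real.exp (-(t / 2)) : ℝ) : ℂ) * ((Real.exp (-(2 * t * (y / 2 - 1 / 4))) : ℝ) : ℂ) =
      ((Real.exp (-(y * t)) : ℝ) : ℂ) := by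
    rw [← Complex.ofReal_mul, ← Real.exp_add]; ring_nf
  rw [hψ]
  linear_combination (-(1 / 2) * Complex.digamma (1 / 4 - (y : ℂ) / 2)) * hexp

/-- The limits of the prime-sum exponentials: for `1 ≤ n ≤ ⌊e^t⌋`, `t ≠ log n`, `e^{−y(t − log n)} → 0`.
[folklore] -/
private theorem tendsto_primeSum {t : ℝ} (hlog : ∀ n : ℕ, t ≠ Real.log n) :
    Tendsto (fun y : ℝ ↦ ∑ n ∈ Finset.Icc 1 ⌊Real.exp t⌋₊,
        ((ArithmeticFunction.vonMangoldt n / Real.sqrt n : ℝ) : ℂ) *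
          (((Real.exp (-(y * (t - Real.log n))) : ℝ) : ℂ) - 1)) atTop
      (𝓝 (∑ n ∈ Finset.Icc 1 ⌊Real.exp t⌋₊,
        ((ArithmeticFunction.vonMangoldt n / Real.sqrt n : ℝ) : ℂ) * (0 - 1))) := by
  refine tendsto_finsetSum _ fun n hn ↦ ?_
  rw [Finset.mem_Icc] at hn
  have hn0 : (0 : ℝ) < n := by exact_mod_cast hn.1
  have hle : Real.log n ≤ t := by
    rw [Real.log_le_iff_le_exp hn0]
    exact (Nat.le_floor_iff (Real.exp_pos _).le).1 hn.2
  have hpos : 0 < t - Real.log n := by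
    rcases hle.lt_or_eq with h | h
    · linarith
    · exact absurd h.symm (hlog n)
  have h := (tendsto_exp_neg_mul hpos).ofReal
  rw [Complex.ofReal_zero] at h
  exact (h.sub_const 1).const_mul _ |>.congr fun y ↦ by ring

/-- **CJM Thm 7.1, (7.2)** (RH-FREE): for `t > 0`, `t ≠ log n`,
`lim_{y→+∞, y∉2ℕ+½} [y𝔓_t(−iy) − ½(Γ′/Γ)(¼ + y/2) + ½log π] = −g_ξ′(t) = Ψ′(t)`, the second conjunct
of `Suzuki2025_thm71` as typed. [cite: Suzuki2025WeilHilbertSpace, Thm. 7.1 (7.2) (TeX l.2121–2129, proof l.2192–2226)] -/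
theorem tendsto_eq72 {t : ℝ} (ht : 0 < t) (hlog : ∀ n : ℕ, t ≠ Real.log n) :
    Tendsto
      (fun y : ℝ ↦ (y : ℂ) * screwP t (-(I * y)) - 1 / 2 * Complex.digamma (1 / 4 + y / 2) +
        1 / 2 * Real.log Real.pi)
      (atTop ⊓ 𝓟 {y : ℝ | ∀ n : ℕ, y ≠ 2 * n + 1 / 2}) (𝓝 ((deriv zetaScrew t : ℝ) : ℂ)) := by
  set L := atTop ⊓ 𝓟 {y : ℝ | ∀ n : ℕ, y ≠ 2 * n + 1 / 2} with hL
  have hLle : L ≤ atTop := inf_le_left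
  -- the scalar inputs
  have hinv1 : Tendsto (fun y : ℝ ↦ (((1 / (1 + 2 * y) : ℝ)) : ℂ)) atTop (𝓝 0) := by
    simpa using tendsto_inv_one_add.ofReal
  have hinv2 : Tendsto (fun y : ℝ ↦ (((1 / (1 - 2 * y) : ℝ)) : ℂ)) atTop (𝓝 0) := by
    simpa using tendsto_inv_one_sub.ofReal
  have hE1 : Tendsto (fun y : ℝ ↦ ((Real.exp (-(y * t)) : ℝ) : ℂ)) atTop (𝓝 0) := by
    simpa using (tendsto_exp_neg_mul ht).ofReal
  -- the seven pieces
  have h1 : Tendsto (fun y : ℝ ↦ 2 * ((Real.exp (t / 2) - 1 : ℝ) : ℂ) -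
      2 * ((Real.exp (t / 2) - 1 : ℝ) : ℂ) * (((1 / (1 + 2 * y) : ℝ)) : ℂ)) atTop
      (𝓝 (2 * ((Real.exp (t / 2) - 1 : ℝ) : ℂ) - 2 * ((Real.exp (t / 2) - 1 : ℝ) : ℂ) * 0)) :=
    tendsto_const_nhds.sub (hinv1.const_mul _)
  have h2 : Tendsto (fun y : ℝ ↦ -(2 * ((Real.exp (-(t / 2)) - 1 : ℝ) : ℂ)) +
      2 * ((Real.exp (-(t / 2)) - 1 : ℝ) : ℂ) * (((1 / (1 - 2 * y) : ℝ)) : ℂ)) atTop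
      (𝓝 (-(2 * ((Real.exp (-(t / 2)) - 1 : ℝ) : ℂ)) + 2 * ((Real.exp (-(t / 2)) - 1 : ℝ) : ℂ) * 0)) :=
    tendsto_const_nhds.add (hinv2.const_mul _)
  have h3 : Tendsto (fun y : ℝ ↦ (1 - ((Real.exp (-(y * t)) : ℝ) : ℂ)) *
      (deriv riemannZeta (1 / 2 + (y : ℂ)) / riemannZeta (1 / 2 + (y : ℂ)))) atTop
      (𝓝 ((1 - 0) * 0)) :=
    (tendsto_const_nhds.sub hE1).mul tendsto_logDerivZeta_half_add
  have h4 : Tendsto (fun y : ℝ ↦ ((Real.exp (-(y * t)) : ℝ) : ℂ) * (Real.log Real.pi : ℂ) -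
      1 / 2 * (((Real.exp (-(y * t)) : ℝ) : ℂ) * Complex.digamma (1 / 4 + (y : ℂ) / 2)) -
      1 / 2 * (Real.log Real.pi : ℂ)) atTop
      (𝓝 (0 * (Real.log Real.pi : ℂ) - 1 / 2 * 0 - 1 / 2 * (Real.log Real.pi : ℂ))) :=
    ((hE1.mul_const _).sub ((tendsto_exp_mul_digamma ht).const_mul _)).sub_const _
  have h5 := tendsto_primeSum hlog
  have h6 : Tendsto (fun _ : ℝ ↦ 1 / 2 * Complex.digamma (1 / 4) +
      1 / 2 * ((Real.exp (-(t / 2)) : ℝ) : ℂ) *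
        ∑' n : ℕ, ((Real.exp (-(2 * t * n)) : ℝ) : ℂ) * (1 / ((n : ℂ) + 1 / 4))) L
      (𝓝 (1 / 2 * Complex.digamma (1 / 4) +
        1 / 2 * ((Real.exp (-(t / 2)) : ℝ) : ℂ) *
          ∑' n : ℕ, ((Real.exp (-(2 * t * n)) : ℝ) : ℂ) * (1 / ((n : ℂ) + 1 / 4)))) :=
    tendsto_const_nhds
  have h7 := tendsto_poleTerm_y ht
  have hall := ((((((h1.mono_left hLle).add (h2.mono_left hLle)).add (h3.mono_left hLle)).add
    (h4.mono_left hLle)).add (h5.mono_left hLle)).add h6).add h7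
  -- the value of the limit
  have hS0 : (∑' n : ℕ, ((Real.exp (-(2 * t * n)) : ℝ) : ℂ) * (1 / ((n : ℂ) + 1 / 4))) =
      ((∑' k : ℕ, Real.exp (-(2 * t * k)) / ((k : ℝ) + 1 / 4) : ℝ) : ℂ) := by
    rw [Complex.ofReal_tsum]
    refine tsum_congr fun n ↦ ?_
    push_cast
    ring
  have hD := (hasDerivAt_zetaScrew_of_pos ht hlog).deriv
  have key : 2 * ((Real.exp (t / 2) - 1 : ℝ) : ℂ) - 2 * ((Real.exp (t / 2) - 1 : ℝ) : ℂ) * 0 +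
      (-(2 * ((Real.exp (-(t / 2)) - 1 : ℝ) : ℂ)) + 2 * ((Real.exp (-(t / 2)) - 1 : ℝ) : ℂ) * 0) +
      (1 - 0) * 0 +
      (0 * (Real.log Real.pi : ℂ) - 1 / 2 * 0 - 1 / 2 * (Real.log Real.pi : ℂ)) +
      (∑ n ∈ Finset.Icc 1 ⌊Real.exp t⌋₊,
        ((ArithmeticFunction.vonMangoldt n / Real.sqrt n : ℝ) : ℂ) * (0 - 1)) +
      (1 / 2 * Complex.digamma (1 / 4) +
        1 / 2 * ((Real.exp (-(t / 2)) : ℝ) : ℂ) *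
          ∑' n : ℕ, ((Real.exp (-(2 * t * n)) : ℝ) : ℂ) * (1 / ((n : ℂ) + 1 / 4))) + 0 =
      ((deriv zetaScrew t : ℝ) : ℂ) := by
    have hsum : (∑ n ∈ Finset.Icc 1 ⌊Real.exp t⌋₊,
        ((ArithmeticFunction.vonMangoldt n / Real.sqrt n : ℝ) : ℂ) * (0 - 1)) =
        -((∑ n ∈ Finset.Icc 1 ⌊Real.exp t⌋₊,
          (ArithmeticFunction.vonMangoldt n / Real.sqrt n : ℝ) : ℝ) : ℂ) := by
      rw [Complex.ofReal_sum, ← Finset.sum_neg_distrib]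
      exact Finset.sum_congr rfl fun n _ ↦ by ring
    rw [hsum, hD, hS0, Literature.Analysis.SpecialFunctions.Complex.digamma_one_quarter_eq_neg_ofReal]
    push_cast
    ring
  rw [key] at hall
  refine hall.congr' ?_
  have hy1 : ∀ᶠ y : ℝ in L, 1 ≤ y := (eventually_ge_atTop (1 : ℝ)).filter_mono hLle
  have hyS : ∀ᶠ y : ℝ in L, ∀ n : ℕ, y ≠ 2 * n + 1 / 2 := mem_inf_of_right (mem_principal_self _)
  filter_upwards [hy1, hyS] with y hy hS
  exact (main_identity ht hy hS).symm

end ScrewValueAtInfinity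

/-- **CJM Thm 7.1 DISCHARGED** (RH-FREE): both special-value identities of the screw line,
(7.1) `𝔓_t(0) = −g_ξ(t) = Ψ(t)` (`Suzuki2025_thm71_eq71`) and (7.2)
`lim_{y→+∞}[y𝔓_t(−iy) − ½(Γ′/Γ)(¼+y/2) + ½log π] = −g_ξ′(t)` for `t > 0`, `t ≠ log n`
(`ScrewValueAtInfinity.tendsto_eq72`), "independently of the truth of the RH".
[cite: Suzuki2025WeilHilbertSpace, Thm. 7.1 (TeX l.2114–2129, proof l.2131–2226)] -/
theorem Suzuki2025_thm71_holds : Suzuki2025_thm71 :=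
  ⟨Suzuki2025_thm71_eq71, fun _ ht hlog ↦ ScrewValueAtInfinity.tendsto_eq72 ht hlog⟩

end Literature.NumberTheory.LFunctions

end
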